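/-
Copyright: the b2b-balaban T⁴-continuum CRUX team, row NE7b leaf lineage `t4-ne7b-formalise-leaf-03` (gen 146). Project licence.
-/
import Summits.QuantumFields.BalabanUV.T4Continuum.Spine.NE7b.ConstrainedValueLagrangian
import Summits.QuantumFields.BalabanUV.T4Continuum.Spine.NE7b.ConstrainedValueSection
import Literature.Analysis.Convex.AlexandrovSemiconvex

/-!
# THE VALUE HESSIAN UNDER A NONLINEAR CONSTRAINT IS THE CONSTRAINED SCHUR FORM OF THE LAGRANGIAN HESSIAN `½(D²V − Λ∘D²G)`: the
# END of `…ConstrainedValueLagrangian` in HESSIAN currency, with the section letter DISCHARGED by the implicit function theorem — for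
# `V` and `Λ ∘ G` twice differentiable at the constrained minimiser `δ₀` and `G` strictly differentiable there,
# `φ (w₀ + h) = φ w₀ + Λ h + ½ (D²V(δ₀) − Λ∘D²G(δ₀))[N h, N h] + o(‖h‖²)` (T-85 (E2) verbatim; row NE7b, node U5c; residual (R2′)
# family (2), letter (ℓ1); sequel of CVL + CVSec with the tree's Peano–Taylor lemma)

Cell `pub-balaban`, sub-cell `t4`, spine estimate NE7b (`T4WeightBudget.RelWeightBound`; the cell's OWN estimate — NOT PRINTED in
[Bałaban 1983–89], NOT PROVED).  Crux-route work under `Spine/NE7b/` by a row leaf on the convexity road; NOTHING of Bałaban's is named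
or asserted; no `T4Continuum/Support` leaf typed (FREEZE (0)); no `def`; zero `sorry`.  Imports: this lineage's `…ConstrainedValueLagrangian`
(CVL, p378628) and `…ConstrainedValueSection` (CVSec) + the BUILT `Literature.Analysis.Convex.AlexandrovSemiconvex` for
`Literature.Analysis.Convex.taylor_two_isLittleO_of_hasFDerivAt`.

WHY.  CVL proves the nonlinear second-order envelope theorem in Peano currency from LETTERS: the two expansions with abstract forms `q`, `s`,
a quadratic modulus of `𝓛 = q − s`, and a section `σ`.  Idea-1's T-85 (E2) speaks HESSIANS: `D²φ(w₀)[h,h] = min {𝓛[v,v] : DG(δ₀)v = h}`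
with the LAGRANGIAN Hessian `𝓛 = D²V(δ₀) − λ∘D²G(δ₀)`.  THIS FILE is that sentence: the forms are `q = ½ V″`, `s = ½ Λ∘G″` from second
derivatives AT THE POINT (the tree's Peano–Taylor lemma applied to `V` and to the scalar function `Λ ∘ G`), the modulus is automatic for
the bilinear form `½(V″ − Λ∘G″)` (CVL §1), and the section comes from CVSec §1 (implicit function theorem with prescribed derivative `N`).

WHAT IS PROVED ([folklore]; Fiacco (1983) §3.2 ∕ Bonnans–Shapiro (2000) §4.7):
* `isLittleO_comp_remainder_of_hasFDerivAt` — the scalarised second-order expansion of the constraint: `HasFDerivAt G (G′ δ) δ` near `δ₀`,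
  `HasFDerivAt G′ G″ δ₀` ⊢ `(v ↦ Λ (G (δ₀ + v) − G δ₀ − G′ δ₀ v) − ½ Λ (G″ v v)) =o[𝓝 0] ‖v‖²` (Peano–Taylor for `Λ ∘ G`).
* **`isLittleO_constrValue_lagrangianHessian`** — `E`, `F` Banach; `T (N w) = w`; `G δ₀ = w₀`; `HasStrictFDerivAt G T δ₀`; derivative
  fields `V′`, `G′` near `δ₀` with `HasFDerivAt V′ V″ δ₀`, `HasFDerivAt G′ G″ δ₀`, `G′ δ₀ = T`; the Lagrange condition `V′ δ₀ = Λ ∘ T`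
  (automatic — `…ConstrainedValueHessian` §4); the constraint-adapted strong letter with `μ > 0` (CVL §2 from the road's letter and print's
  (135)); `N` minimising the Lagrangian Hessian form `v ↦ V″ v v − Λ (G″ v v)` on the fibres of `T` ⊢
  `(h ↦ φ (w₀ + h) − φ w₀ − Λ h − ½ (V″ (N h) (N h) − Λ (G″ (N h) (N h)))) =o[𝓝 0] ‖h‖²`.

NOT HERE (honest): the fibre-minimiser map `N` itself (CSTF §4 from CVSec §2's coercivity, finite dimension); `C²` of `φ`; gauge orbits
and the nested insertion (T-85 #28–#29); which `V`, `G`, `Λ` of Bałaban's ((A3) ∕ (A1c), NC-NE7b-α UNRULED); any value.  BY-NAME EFFECT ON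
THE WALL: NONE.  NE7b NOT PRINTED ∕ NOT PROVED; spine PROVED 0∕9; rung (B)+1 on a FINITE torus — NOT infinite volume, NOT the mass gap,
NOT Clay.  HONEST DEPENDENCY: continuum YM on T⁴ ⇐ BetaPertH ∧ nine spine estimates (0/9 proved); BetaPertH ⇐ (D1) ∧ (D4) ∧ CAP+tail;
G-an2-4 gates asym, D1 and NE2∕3∕4.
-/

set_option autoImplicit false

open Set Function Filter Asymptotics Metric
open scoped Topology
open Summit.QuantumFields.BalabanUV.T4Continuum.NE7b.ConstrainedValueLagrangian
open Summit.QuantumFields.BalabanUV.T4Continuum.NE7b.ConstrainedValueSection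

namespace Summit.QuantumFields.BalabanUV.T4Continuum.NE7b.ConstrainedValueLagrangianHessian

variable {E F : Type*} [NormedAddCommGroup E] [NormedSpace ℝ E] [NormedAddCommGroup F] [NormedSpace ℝ F]

/-- **THE SCALARISED SECOND-ORDER EXPANSION OF THE CONSTRAINT.**  `G` differentiable near `δ₀` with derivative field `G′`,
`HasFDerivAt G′ G″ δ₀`, `Λ : F →L ℝ` ⟹ `(v ↦ Λ (G (δ₀ + v) − G δ₀ − G′ δ₀ v) − ½ Λ (G″ v v)) =o[𝓝 0] ‖v‖²` — the tree's Peano–Taylor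
lemma for the scalar function `Λ ∘ G` (derivative field `Λ ∘L G′`, second derivative `compL Λ ∘L G″`); this is CVL's letter `hG2` with
`T = G′ δ₀`, `s v = ½ Λ (G″ v v)` (print's «multiplier × curvature» `⟨HC⁽²⁾(v), J⟩`). [folklore] -/
theorem isLittleO_comp_remainder_of_hasFDerivAt {G : E → F} {G' : E → E →L[ℝ] F} {G'' : E →L[ℝ] E →L[ℝ] F} {δ₀ : E}
    (Λ : F →L[ℝ] ℝ) (hG' : ∀ᶠ δ in 𝓝 δ₀, HasFDerivAt G (G' δ) δ) (hG'' : HasFDerivAt G' G'' δ₀) :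
    (fun v => Λ (G (δ₀ + v) - G δ₀ - G' δ₀ v) - Λ (G'' v v) / 2) =o[𝓝 (0 : E)] fun v => ‖v‖ ^ 2 := by
  have h1 : ∀ᶠ δ in 𝓝 δ₀, HasFDerivAt (fun x => Λ (G x)) (ContinuousLinearMap.compL ℝ E F ℝ Λ (G' δ)) δ :=
    hG'.mono fun δ hδ => (Λ.hasFDerivAt.comp δ hδ).congr_fderiv (by rw [ContinuousLinearMap.compL_apply])
  have h2 : HasFDerivAt (fun x => ContinuousLinearMap.compL ℝ E F ℝ Λ (G' x)) ((ContinuousLinearMap.compL ℝ E F ℝ Λ).comp G'') δ₀ :=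
    (ContinuousLinearMap.compL ℝ E F ℝ Λ).hasFDerivAt.comp δ₀ hG''
  have h3 := Literature.Analysis.Convex.taylor_two_isLittleO_of_hasFDerivAt h1 h2
  refine h3.congr' (Eventually.of_forall fun v => ?_) EventuallyEq.rfl
  simp only [ContinuousLinearMap.compL_apply, ContinuousLinearMap.comp_apply, map_sub]

/-- **THE VALUE HESSIAN UNDER A NONLINEAR CONSTRAINT = THE CONSTRAINED SCHUR FORM OF THE LAGRANGIAN HESSIAN (T-85 (E2)).**  `E`, `F`
Banach; `N` a continuous right inverse of `T`; `G δ₀ = w₀` with `G` STRICTLY differentiable at `δ₀` (derivative `T` — for the section,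
CVSec §1) and differentiable near `δ₀` with `HasFDerivAt G′ G″ δ₀`, `G′ δ₀ = T`; `V` differentiable near `δ₀` with `HasFDerivAt V′ V″ δ₀`;
the Lagrange condition `V′ δ₀ = Λ ∘ T`; the constraint-adapted strong letter `V δ₀ + Λ (G δ − G δ₀) + μ‖δ − δ₀‖² ≤ V δ`, `μ > 0`; and
`N` minimising the Lagrangian Hessian form `v ↦ V″ v v − Λ (G″ v v)` on the fibres of `T` ⟹
`(h ↦ φ (w₀ + h) − φ w₀ − Λ h − ½ (V″ (N h) (N h) − Λ (G″ (N h) (N h)))) =o[𝓝 0] ‖h‖²`, `φ w = ⨅_{G δ = w} V δ`: the value function's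
second-order term is HALF THE CONSTRAINED SCHUR FORM OF THE LAGRANGIAN HESSIAN `D²V(δ₀) − Λ∘D²G(δ₀)` — CVL §5 fed with the tree's
Peano–Taylor lemma (for `V` and for `Λ ∘ G`), CVL §1's bilinear modulus, and CVSec §1's section. [folklore] -/
theorem isLittleO_constrValue_lagrangianHessian [CompleteSpace E] [CompleteSpace F] {V : E → ℝ} {V' : E → E →L[ℝ] ℝ}
    {V'' : E →L[ℝ] E →L[ℝ] ℝ} {G : E → F} {G' : E → E →L[ℝ] F} {G'' : E →L[ℝ] E →L[ℝ] F} {Λ : F →L[ℝ] ℝ} {T : E →L[ℝ] F}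
    {N : F →L[ℝ] E} (hN : ∀ w, T (N w) = w) {w₀ : F} {δ₀ : E} (hG0 : G δ₀ = w₀) (hGs : HasStrictFDerivAt G T δ₀)
    (hG' : ∀ᶠ δ in 𝓝 δ₀, HasFDerivAt G (G' δ) δ) (hT : G' δ₀ = T) (hG'' : HasFDerivAt G' G'' δ₀)
    (hV : ∀ᶠ δ in 𝓝 δ₀, HasFDerivAt V (V' δ) δ) (hV'' : HasFDerivAt V' V'' δ₀) (hlag : ∀ v, V' δ₀ v = Λ (T v))
    {μ : ℝ} (hμ : 0 < μ) (hfoG : ∀ δ, V δ₀ + Λ (G δ - G δ₀) + μ * ‖δ - δ₀‖ ^ 2 ≤ V δ)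
    (hNmin : ∀ v, V'' (N (T v)) (N (T v)) - Λ (G'' (N (T v)) (N (T v))) ≤ V'' v v - Λ (G'' v v)) :
    (fun h => (⨅ δ : {δ // G δ = w₀ + h}, V δ.1) - (⨅ δ : {δ // G δ = w₀}, V δ.1) - Λ h
        - (V'' (N h) (N h) - Λ (G'' (N h) (N h))) / 2) =o[𝓝 (0 : F)] fun h => ‖h‖ ^ 2 := by
  obtain ⟨σ, hσ, hσ1⟩ := exists_section_isLittleO hN hG0 hGs
  have hV2 := Literature.Analysis.Convex.taylor_two_isLittleO_of_hasFDerivAt hV hV''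
  have hG2 : (fun v => Λ (G (δ₀ + v) - G δ₀ - T v) - Λ (G'' v v) / 2) =o[𝓝 (0 : E)] fun v => ‖v‖ ^ 2 := by
    simpa only [hT] using isLittleO_comp_remainder_of_hasFDerivAt Λ hG' hG''
  -- the Lagrangian Hessian form as a bounded bilinear form, and its quadratic modulus
  set B : E →L[ℝ] E →L[ℝ] ℝ := (1 / 2 : ℝ) • (V'' - (ContinuousLinearMap.compL ℝ E F ℝ Λ).comp G'') with hB
  have hBapply : ∀ u v : E, B u v = (V'' u v - Λ (G'' u v)) / 2 := by
    intro u v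
    simp only [hB, smul_apply, sub_apply, ContinuousLinearMap.comp_apply, ContinuousLinearMap.compL_apply, smul_eq_mul]
    ring
  have hLmod : ∀ u v : E, |(V'' u u - Λ (G'' u u)) / 2 - (V'' v v - Λ (G'' v v)) / 2| ≤ ‖B‖ * (‖u‖ + ‖v‖) * ‖u - v‖ := by
    intro u v
    rw [← hBapply, ← hBapply]
    exact abs_bilin_sub_bilin_le B u v
  have hmain := isLittleO_constrValue_lagrangian (q := fun v => V'' v v / 2) (s := fun v => Λ (G'' v v) / 2)
    (L := fun v => (V'' v v - Λ (G'' v v)) / 2) (N := N) hG0 hGs.hasFDerivAt hlag hμ hfoG hV2 hG2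
    (fun v => by ring) hLmod (fun v => by have := hNmin v; linarith) hσ hσ1
  exact hmain

end Summit.QuantumFields.BalabanUV.T4Continuum.NE7b.ConstrainedValueLagrangianHessian
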